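import Summits.QuantumFields.BalabanUV.Beta.EriceRemainderEnclosureHistoryAutonomyComparisonAgeCompositionStaticChainMoments

/-!
# EriceRemainderEnclosureHistoryAutonomyComparisonAgeCompositionStaticChainMonotoneGame — (E76a) THE COMPOUNDING SIDE OF THE WINDOW-MASS CHAIN AS AN
# ORDER-PRESERVING REGISTER PAIR `(m₁, V)`, AND THE SIMULATION THEOREM WITH ROUNDING: any register sequences that dominate the exact updates
# `m₁ ↦ μ(m₁+ρ)∕(1−ρ)`, `V ↦ μ²(V + θ̄(1)ρ + 2(m₁+ρ)(1∕μ−1))∕(1−ρ)` (`μ = a_{m+1}∕a_m` the descent to the next young scale), fed with dominating loads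
# `x̂ ≥ x` and window masses `Ω̂ ≥ Ω`, produce ratios `ρ̂_m ≥ ρ_m` — so a register game that CLOSES forces the static chain to close; plus the budget-side
# register laws (usage decays no faster than `1∕λ`; the two-register descent law; far-line folding) that make «forgetting a coordinate» safe

Cell `pub-balaban`, β-function sub-cell, BINDER row D4 «RemainderConst leaves for Bałaban's split» (`HOME/BINDER-OWNERS.md`; owner lineage `b2b-balaban-beta-an4`;
this file by co-owner #2 lineage `b2b-balaban-beta-d4-p2`, generation 67), β-FLOW TEAM duty (1), FREEZE (0) honoured (def-free; imports (E75c)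
`…StaticChainMoments`; uses `moment_succ`, `moment_rescale`, `thetabar_le_chord`, `psi_one_bounds` (E75c) and `thetabar_mem_unit_interval` (E72c) BY NAME;
nothing restated).

HONEST FRAMING (page 1, verbatim and binding).  *"Discharging BetaPertH makes Bałaban's UV stability UNCONDITIONAL — a real constructive-QFT result; it is
NOT the continuum limit and NOT the Clay problem."*  THIS FILE DISCHARGES NOTHING OF THE KIND.  Elementary algebra of finite sums and fractions and three
square-root inequalities — hypotheses of a census, not facts; the form, signs, ages and moments of Bałaban's (1.22) limit functional are NOT PRINTED ([I]
p. 298; GAPS G-t4-U2-1∕-2) and NOT asserted.  Row D4 class UNCHANGED (critical-path width 0; instance 0∕1; D4 DISCHARGE NO DATE).  HONEST DEPENDENCY: continuum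
YM on T⁴ ⇐ BetaPertH ∧ nine spine estimates (0/9 proved); BetaPertH ⇐ (D1) ∧ (D4) ∧ CAP+tail; G-an2-4 gates asym, D1 and NE2/3/4.

THE POINT (README `HOME/b2b-balaban-beta-d4-p2/g67/e76/README.md`; successor item (1) of `g66/e75/README.md` §6 «architecture M»).  (E75c) made the compounding
side of the static chain an exact moment state `(m₁, m₂, …)` with the rigorous chord envelope `V ≤ 2m₁ − (2−θ̄(1))m₂`; but `V` DECREASES in `m₂`, so the moment
state is not order-preserving and no box∕corner argument applies to it.  In the coordinates `(m₁, V)` — `V` the chord VALUE itself — the exact update under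
«add the young with ratio `ρ`, then descend by `μ = a_{m+1}∕a_m`» is `m₁' = μ(m₁+ρ)∕(1−ρ)`, `V' = μ²(V + θ̄(1)ρ + 2(m₁+ρ)(1∕μ − 1))∕(1−ρ)`: INCREASING in
`m₁`, `V` and `ρ`.  Consequences proved here: (i) the register pair may be ROUNDED UP at every step and still dominates the true chord value, hence the true
chain load (§2–§3: `register_inv_succ`, the simulation theorem `ratio_le_of_registers` — (E72a)'s majorant principle for a state-compressed game with
inequalities in place of the update identities, which is what an outward-rounded float∕interval certificate replays); (ii) the one-step map is monotone in
the state (§1, §3 `register_map_mono`, `ratio_mono`), so an invariant region of the register game may be taken to be a DOWN-SET and its closure checked at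
maximal elements only; (iii) on the budget side (§4, continuum letters `g(u) = 2(√(1+u)−1)` = charge of an older load at relative position `u = y∕k` on the
young's line, `c(σ) = 2(√(σ+σ²)−σ)` = charge of the young on an older line at `σ = y∕J`): the usage of the young's own line by older loads decays no faster
than `1∕λ` under a descent by `λ` (`usage_charge_scale`), the two-register law `M₁∕λ − (M₁−U)∕λ²` is a lower bound of the usage monotone in both registers
(`two_register_descent_le_usage`, `two_register_descent_mono`), and a far line folds into the aggregate `Σ x√k` (`young_charge_ge_fold`) — the three facts
that make every coordinate of architecture M FORGETTABLE at its worst value (README §2).  Numerics of record (kit j314353 = `g67/numerics/job19`): the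
dimension sweep of the monotone relaxed game.  NOT CLAIMED: any invariant region; the static closure; anything on the lattice layer; anything printed.

WHAT IS PROVED ([folklore]; 0 `def`, 0 sorry).  §1 `frac_step_mono`, `ratio_mono`.  §2 `moment_step_rescaled` (exact transport of every moment across «add, then
descend»), `second_moment_le_first`, `load_le_chord` (the chord majorant of the true load with the optimal constant `2 − θ̄(1)`), `chord_nonneg`.  §3
**`register_inv_succ`**, **`register_map_mono`**, **`ratio_le_of_registers`** (THE SIMULATION THEOREM WITH ROUNDING).  §4 `usage_charge_ge_linear`,
**`usage_charge_scale`**, `two_register_descent_mono`, **`two_register_descent_le_usage`**, `young_charge_ge_fold`.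
-/
noncomputable section
open Finset

namespace Summit.QuantumFields.BalabanUV.Beta.EriceRemainderEnclosureHistoryAutonomyComparisonAgeCompositionStaticChainMonotoneGame

open Summit.QuantumFields.BalabanUV.Beta.EriceRemainderEnclosureHistoryAutonomyComparisonAgeCompositionStaticChainMoments
  (moment_succ moment_rescale thetabar_le_chord psi_one_bounds)
open Summit.QuantumFields.BalabanUV.Beta.EriceRemainderEnclosureHistoryAutonomyComparisonAgeCompositionStaticChainHyperbolic (thetabar_mem_unit_interval)

/-! ## §1 Elementary monotonicity of the register maps -/

/-- The linear-fractional step `(A + Bρ)∕(1−ρ)` is monotone in `A ≥ 0` and in `ρ ∈ [0,1)` when `B ≥ 0`. [folklore] -/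
theorem frac_step_mono {A A' B ρ ρ' : ℝ} (hA : 0 ≤ A) (hAA : A ≤ A') (hB : 0 ≤ B) (hρ : 0 ≤ ρ) (hρρ : ρ ≤ ρ') (hρ'1 : ρ' < 1) :
    (A + B * ρ) / (1 - ρ) ≤ (A' + B * ρ') / (1 - ρ') := by
  have hn : A + B * ρ ≤ A' + B * ρ' := add_le_add hAA (mul_le_mul_of_nonneg_left hρρ hB)
  have hn0 : 0 ≤ A + B * ρ := add_nonneg hA (mul_nonneg hB hρ)
  exact div_le_div₀ (hn0.trans hn) hn (sub_pos.mpr hρ'1) (by linarith)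

/-- The KEY ratio `x(1+V)∕(1−Ω)` is monotone in the load `x ≥ 0`, the chain load `V ≥ 0` and the window mass `Ω < 1`. [folklore] -/
theorem ratio_mono {x x' V V' Ω Ω' : ℝ} (hx : 0 ≤ x) (hxx : x ≤ x') (hV : 0 ≤ V) (hVV : V ≤ V') (hΩΩ : Ω ≤ Ω') (hΩ'1 : Ω' < 1) :
    x * (1 + V) / (1 - Ω) ≤ x' * (1 + V') / (1 - Ω') := by
  have hn : x * (1 + V) ≤ x' * (1 + V') := mul_le_mul hxx (by linarith) (by linarith) (hx.trans hxx)
  have hn0 : 0 ≤ x * (1 + V) := mul_nonneg hx (by linarith)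
  exact div_le_div₀ (hn0.trans hn) hn (sub_pos.mpr hΩ'1) (by linarith)

/-! ## §2 Exact moment transport, and the chord majorant of the true load -/

/-- **MOMENT TRANSPORT ACROSS «ADD THE YOUNG, THEN DESCEND».**  Under the static chain's update ((E72a) `hnew`∕`hold` at step `m`, young scale `a_m`), the
`p`-th moment seen from the NEXT young scale `a_{m+1}` is `Σ_{i<m+1} (a_{m+1}∕a_i)^p b_{m+1,i} = (a_{m+1}∕a_m)^p·(Σ_{i<m} (a_m∕a_i)^p b_{m,i} + ρ_m)∕(1−ρ_m)`
((E75c) `moment_rescale` + `moment_succ`). [folklore] -/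
theorem moment_step_rescaled {a ρ : ℕ → ℝ} {b : ℕ → ℕ → ℝ} (ha : ∀ i, 0 < a i)
    (hnew : ∀ m, b (m + 1) m = ρ m / (1 - ρ m)) (hold : ∀ m i, i < m → b (m + 1) i = b m i / (1 - ρ m)) (p m : ℕ) :
    ∑ i ∈ range (m + 1), (a (m + 1) / a i) ^ p * b (m + 1) i =
      (a (m + 1) / a m) ^ p * ((∑ i ∈ range m, (a m / a i) ^ p * b m i + ρ m) / (1 - ρ m)) := by
  rw [moment_rescale a (b (m + 1)) (ha m).ne' (a (m + 1)) p (m + 1), moment_succ hnew hold (fun i => (a m / a i) ^ p) m,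
    div_self (ha m).ne', one_pow, one_mul]

/-- The second moment is below the first: `Σ (a_m∕a_i)² b_{m,i} ≤ Σ (a_m∕a_i) b_{m,i}` for `b ≥ 0` and ages processed oldest first (`a_m ≤ a_i`). [folklore] -/
theorem second_moment_le_first {a : ℕ → ℝ} {b : ℕ → ℕ → ℝ} (ha : ∀ i, 0 < a i) {m : ℕ} (hord : ∀ i, i < m → a m ≤ a i)
    (hb : ∀ i, i < m → 0 ≤ b m i) :
    ∑ i ∈ range m, (a m / a i) ^ 2 * b m i ≤ ∑ i ∈ range m, (a m / a i) * b m i := by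
  refine sum_le_sum fun i hi => mul_le_mul_of_nonneg_right ?_ (hb i (mem_range.mp hi))
  have h1 : a m / a i ≤ 1 := (div_le_one (ha i)).mpr (hord i (mem_range.mp hi))
  have h0 : 0 ≤ a m / a i := (div_pos (ha m) (ha i)).le
  nlinarith

/-- **THE CHORD MAJORANT OF THE TRUE CHAIN LOAD** (optimal constant): with `ψ₁ = ½·√½·e^{−½} = 1 − θ̄(1)`, ages processed oldest first and `b ≥ 0`,
`Σ_{i<m} θ̄(a_i∕a_m)·b_{m,i} ≤ 2·Σ (a_m∕a_i) b_{m,i} − (1+ψ₁)·Σ (a_m∕a_i)² b_{m,i}` ((E75c) `thetabar_le_chord` termwise). [folklore] -/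
theorem load_le_chord {a : ℕ → ℝ} {b : ℕ → ℕ → ℝ} (ha : ∀ i, 0 < a i) {m : ℕ} (hord : ∀ i, i < m → a m ≤ a i)
    (hb : ∀ i, i < m → 0 ≤ b m i) :
    ∑ i ∈ range m, (1 - (a i / a m) / (a i / a m + 1) * Real.sqrt ((a i / a m) / (a i / a m + 1)) * Real.exp (-(1 / (2 * (a i / a m))))) * b m i ≤
      2 * ∑ i ∈ range m, (a m / a i) * b m i -
        (1 + 1 / (1 + 1) * Real.sqrt (1 / (1 + 1)) * Real.exp (-(1 / (2 * 1)))) * ∑ i ∈ range m, (a m / a i) ^ 2 * b m i := by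
  rw [mul_sum, mul_sum, ← sum_sub_distrib]
  refine sum_le_sum fun i hi => ?_
  have him := mem_range.mp hi
  have hr : 1 ≤ a i / a m := (one_le_div (ha m)).mpr (hord i him)
  have h := thetabar_le_chord hr
  have e1 : 2 / (a i / a m) = 2 * (a m / a i) := by field_simp
  have e2 : (2 - (1 - 1 / (1 + 1) * Real.sqrt (1 / (1 + 1)) * Real.exp (-(1 / (2 * 1))))) / (a i / a m) ^ 2 =
      (1 + 1 / (1 + 1) * Real.sqrt (1 / (1 + 1)) * Real.exp (-(1 / (2 * 1)))) * (a m / a i) ^ 2 := by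
    field_simp; ring
  rw [e1, e2] at h
  have := mul_le_mul_of_nonneg_right h (hb i him)
  linarith [this]

/-- The chord value is non-negative and dominates `(1−ψ₁)·m₁ ≥ 0`: `0 ≤ 2m₁ − (1+ψ₁)m₂` whenever `0 ≤ m₂ ≤ m₁` (`ψ₁ ≤ 0.2145 < 1`). [folklore] -/
theorem chord_nonneg {s₁ s₂ : ℝ} (h0 : 0 ≤ s₂) (h21 : s₂ ≤ s₁) :
    0 ≤ 2 * s₁ - (1 + 1 / (1 + 1) * Real.sqrt (1 / (1 + 1)) * Real.exp (-(1 / (2 * 1)))) * s₂ := by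
  have hψ := psi_one_bounds.2
  nlinarith

/-! ## §3 The register pair `(m₁, V)`: invariant, monotonicity, simulation -/

/-- **THE REGISTER INVARIANT SURVIVES ONE STEP, WITH ROUNDING.**  Static chain (E72a) with ages `a_i > 0` processed oldest first; at step `m` suppose the
registers dominate the true first moment and the true chord value — `Σ_{i<m}(a_m∕a_i)b_{m,i} ≤ m₁`, `2Σ(a_m∕a_i)b_{m,i} − (1+ψ₁)Σ(a_m∕a_i)²b_{m,i} ≤ V` — the
true ratio is dominated, `0 ≤ ρ_m ≤ ρ̂ < 1`, and the next registers dominate the EXACT images, `μ(m₁+ρ̂)∕(1−ρ̂) ≤ m₁'` and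
`μ²(V + (1−ψ₁)ρ̂ + 2(m₁+ρ̂)(1∕μ−1))∕(1−ρ̂) ≤ V'` (`μ = a_{m+1}∕a_m`).  Then the registers dominate at step `m+1` as well (and `b_{m+1,·} ≥ 0`). [folklore] -/
theorem register_inv_succ {a ρ : ℕ → ℝ} {b : ℕ → ℕ → ℝ} (ha : ∀ i, 0 < a i) (hanti : ∀ i j, i ≤ j → a j ≤ a i)
    (hnew : ∀ m, b (m + 1) m = ρ m / (1 - ρ m)) (hold : ∀ m i, i < m → b (m + 1) i = b m i / (1 - ρ m))
    {m : ℕ} {m₁ V ρh m₁' V' : ℝ} (hb : ∀ i, i < m → 0 ≤ b m i) (hρ0 : 0 ≤ ρ m) (hρρ : ρ m ≤ ρh) (hρh1 : ρh < 1)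
    (hm₁ : ∑ i ∈ range m, (a m / a i) * b m i ≤ m₁)
    (hV : 2 * ∑ i ∈ range m, (a m / a i) * b m i -
      (1 + 1 / (1 + 1) * Real.sqrt (1 / (1 + 1)) * Real.exp (-(1 / (2 * 1)))) * ∑ i ∈ range m, (a m / a i) ^ 2 * b m i ≤ V)
    (hm₁' : (a (m + 1) / a m) * ((m₁ + ρh) / (1 - ρh)) ≤ m₁')
    (hV' : (a (m + 1) / a m) ^ 2 * ((V + (1 - 1 / (1 + 1) * Real.sqrt (1 / (1 + 1)) * Real.exp (-(1 / (2 * 1)))) * ρh +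
      2 * (m₁ + ρh) * (a m / a (m + 1) - 1)) / (1 - ρh)) ≤ V') :
    (∀ i, i < m + 1 → 0 ≤ b (m + 1) i) ∧
    ∑ i ∈ range (m + 1), (a (m + 1) / a i) * b (m + 1) i ≤ m₁' ∧
    2 * ∑ i ∈ range (m + 1), (a (m + 1) / a i) * b (m + 1) i -
      (1 + 1 / (1 + 1) * Real.sqrt (1 / (1 + 1)) * Real.exp (-(1 / (2 * 1)))) * ∑ i ∈ range (m + 1), (a (m + 1) / a i) ^ 2 * b (m + 1) i ≤ V' := by
  set ψ₁ := (1 : ℝ) / (1 + 1) * Real.sqrt (1 / (1 + 1)) * Real.exp (-(1 / (2 * 1))) with hψ₁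
  set s₁ := ∑ i ∈ range m, (a m / a i) * b m i with hs₁
  set s₂ := ∑ i ∈ range m, (a m / a i) ^ 2 * b m i with hs₂
  set μ := a (m + 1) / a m with hμ
  have hρ1 : ρ m < 1 := lt_of_le_of_lt hρρ hρh1
  have h1ρ : 0 < 1 - ρ m := sub_pos.mpr hρ1
  have hord : ∀ i, i < m → a m ≤ a i := fun i hi => hanti i m hi.le
  have hs₂0 : 0 ≤ s₂ := sum_nonneg fun i hi => mul_nonneg (sq_nonneg _) (hb i (mem_range.mp hi))
  have hs₂₁ : s₂ ≤ s₁ := second_moment_le_first ha hord hb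
  have hs₁0 : 0 ≤ s₁ := hs₂0.trans hs₂₁
  have hψ := psi_one_bounds
  have hμ0 : 0 < μ := div_pos (ha (m + 1)) (ha m)
  have hμ1 : μ ≤ 1 := (div_le_one (ha m)).mpr (hanti m (m + 1) (Nat.le_succ m))
  have hlam : 1 ≤ a m / a (m + 1) := (one_le_div (ha (m + 1))).mpr (hanti m (m + 1) (Nat.le_succ m))
  -- positivity of the new carried ratios
  have hb' : ∀ i, i < m + 1 → 0 ≤ b (m + 1) i := by
    intro i hi
    rcases Nat.lt_succ_iff_lt_or_eq.mp hi with h | h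
    · rw [hold m i h]; exact div_nonneg (hb i h) h1ρ.le
    · subst h; rw [hnew]; exact div_nonneg hρ0 h1ρ.le
  -- exact transport of the two moments
  have e₁ : ∑ i ∈ range (m + 1), (a (m + 1) / a i) * b (m + 1) i = μ * ((s₁ + ρ m) / (1 - ρ m)) := by
    have h := moment_step_rescaled ha hnew hold 1 m
    simp only [pow_one] at h
    rw [h]
  have e₂ : ∑ i ∈ range (m + 1), (a (m + 1) / a i) ^ 2 * b (m + 1) i = μ ^ 2 * ((s₂ + ρ m) / (1 - ρ m)) :=
    moment_step_rescaled ha hnew hold 2 m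
  refine ⟨hb', ?_, ?_⟩
  · -- first register
    rw [e₁]
    have h := frac_step_mono (B := 1) hs₁0 hm₁ zero_le_one hρ0 hρρ hρh1
    simp only [one_mul] at h
    exact (mul_le_mul_of_nonneg_left h hμ0.le).trans hm₁'
  · -- second register: the chord value transported exactly, then dominated
    rw [e₁, e₂]
    have eV : 2 * (μ * ((s₁ + ρ m) / (1 - ρ m))) - (1 + ψ₁) * (μ ^ 2 * ((s₂ + ρ m) / (1 - ρ m))) =
        μ ^ 2 * (((2 * s₁ - (1 + ψ₁) * s₂ + 2 * s₁ * (a m / a (m + 1) - 1)) + ((1 - ψ₁) + 2 * (a m / a (m + 1) - 1)) * ρ m) / (1 - ρ m)) := by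
      have hlam' : a m / a (m + 1) = 1 / μ := by rw [hμ, one_div_div]
      rw [hlam']
      field_simp
      ring
    rw [eV]
    have hA0 : 0 ≤ 2 * s₁ - (1 + ψ₁) * s₂ + 2 * s₁ * (a m / a (m + 1) - 1) :=
      add_nonneg (chord_nonneg hs₂0 hs₂₁) (mul_nonneg (by linarith) (by linarith))
    have hAA : 2 * s₁ - (1 + ψ₁) * s₂ + 2 * s₁ * (a m / a (m + 1) - 1) ≤ V + 2 * m₁ * (a m / a (m + 1) - 1) :=
      add_le_add hV (mul_le_mul_of_nonneg_right (by linarith) (by linarith))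
    have hB0 : 0 ≤ (1 - ψ₁) + 2 * (a m / a (m + 1) - 1) := by linarith [hψ.2]
    have h := frac_step_mono hA0 hAA hB0 hρ0 hρρ hρh1
    have h' := mul_le_mul_of_nonneg_left h (sq_nonneg μ)
    refine h'.trans (le_of_eq_of_le ?_ hV')
    congr 1
    congr 1
    ring

/-- **THE REGISTER MAP IS ORDER-PRESERVING.**  The exact image `(μ(m₁+ρ)∕(1−ρ), μ²(V + (1−ψ₁)ρ + 2(m₁+ρ)(1∕μ − 1))∕(1−ρ))` of «add the young with ratio
`ρ`, descend by `μ ∈ (0,1]`» is monotone in `m₁ ≥ 0`, `V ≥ 0` and `ρ ∈ [0,1)` — so a down-set of register states is mapped into a down-set, and the closure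
of an invariant region need only be checked at its maximal elements. [folklore] -/
theorem register_map_mono {m₁ m₁' V V' ρ ρ' μ : ℝ} (hμ0 : 0 < μ) (hμ1 : μ ≤ 1) (hm : 0 ≤ m₁) (hmm : m₁ ≤ m₁') (hV : 0 ≤ V) (hVV : V ≤ V')
    (hρ : 0 ≤ ρ) (hρρ : ρ ≤ ρ') (hρ'1 : ρ' < 1) :
    μ * ((m₁ + ρ) / (1 - ρ)) ≤ μ * ((m₁' + ρ') / (1 - ρ')) ∧
    μ ^ 2 * ((V + (1 - 1 / (1 + 1) * Real.sqrt (1 / (1 + 1)) * Real.exp (-(1 / (2 * 1)))) * ρ + 2 * (m₁ + ρ) * (1 / μ - 1)) / (1 - ρ)) ≤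
      μ ^ 2 * ((V' + (1 - 1 / (1 + 1) * Real.sqrt (1 / (1 + 1)) * Real.exp (-(1 / (2 * 1)))) * ρ' + 2 * (m₁' + ρ') * (1 / μ - 1)) / (1 - ρ')) := by
  have hψ := psi_one_bounds
  have hl : 0 ≤ 1 / μ - 1 := by
    have : 1 ≤ 1 / μ := by rw [le_div_iff₀ hμ0, one_mul]; exact hμ1
    linarith
  constructor
  · have h := frac_step_mono (B := 1) hm hmm zero_le_one hρ hρρ hρ'1
    simp only [one_mul] at h
    exact mul_le_mul_of_nonneg_left h hμ0.le
  · have e : ∀ W n r : ℝ, W + (1 - 1 / (1 + 1) * Real.sqrt (1 / (1 + 1)) * Real.exp (-(1 / (2 * 1)))) * r + 2 * (n + r) * (1 / μ - 1) =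
        (W + 2 * n * (1 / μ - 1)) + ((1 - 1 / (1 + 1) * Real.sqrt (1 / (1 + 1)) * Real.exp (-(1 / (2 * 1)))) + 2 * (1 / μ - 1)) * r :=
      fun W n r => by ring
    rw [e, e]
    have hA0 : 0 ≤ V + 2 * m₁ * (1 / μ - 1) := add_nonneg hV (by positivity)
    have hAA : V + 2 * m₁ * (1 / μ - 1) ≤ V' + 2 * m₁' * (1 / μ - 1) := add_le_add hVV (by nlinarith)
    have hB0 : 0 ≤ (1 - 1 / (1 + 1) * Real.sqrt (1 / (1 + 1)) * Real.exp (-(1 / (2 * 1)))) + 2 * (1 / μ - 1) := by linarith [hψ.2]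
    exact mul_le_mul_of_nonneg_left (frac_step_mono hA0 hAA hB0 hρ hρρ hρ'1) (sq_nonneg μ)

/-- **THE SIMULATION THEOREM WITH ROUNDING.**  The static chain of (E72a) with the universal defects `θ̄(a_i∕a_m)` (ages `a_i > 0` processed oldest first),
loads `x ≥ 0` and window masses `Ω`; and ANY register sequences `m₁, V, x̂, Ω̂, ρ̂` with `m₁(0), V(0) ≥ 0`, `x ≤ x̂`, `Ω ≤ Ω̂ < 1`,
`x̂(1+V)∕(1−Ω̂) ≤ ρ̂`, and the ROUNDED-UP register updates `μ_m(m₁+ρ̂)∕(1−ρ̂) ≤ m₁(m+1)`, `μ_m²(V + (1−ψ₁)ρ̂ + 2(m₁+ρ̂)(1∕μ_m − 1))∕(1−ρ̂) ≤ V(m+1)`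
(`μ_m = a_{m+1}∕a_m`).  If the register game closes on the first `M` steps (`ρ̂_m < 1`), then so does the static chain, with `0 ≤ ρ_m ≤ ρ̂_m < 1` — the
registers dominate the true first moment and chord value at every step (§2 `load_le_chord`, `register_inv_succ`). [folklore] -/
theorem ratio_le_of_registers {a x Ω ρ : ℕ → ℝ} {b : ℕ → ℕ → ℝ} {m₁ V xh Ωh ρh : ℕ → ℝ}
    (ha : ∀ i, 0 < a i) (hanti : ∀ i j, i ≤ j → a j ≤ a i)
    (hρ : ∀ m, ρ m = x m * (1 + ∑ i ∈ range m,
      (1 - (a i / a m) / (a i / a m + 1) * Real.sqrt ((a i / a m) / (a i / a m + 1)) * Real.exp (-(1 / (2 * (a i / a m))))) * b m i) / (1 - Ω m))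
    (hnew : ∀ m, b (m + 1) m = ρ m / (1 - ρ m)) (hold : ∀ m i, i < m → b (m + 1) i = b m i / (1 - ρ m))
    (h0 : 0 ≤ m₁ 0 ∧ 0 ≤ V 0) (hx : ∀ m, 0 ≤ x m ∧ x m ≤ xh m) (hΩ : ∀ m, Ω m ≤ Ωh m ∧ Ωh m < 1)
    (hρh : ∀ m, xh m * (1 + V m) / (1 - Ωh m) ≤ ρh m)
    (hm₁ : ∀ m, (a (m + 1) / a m) * ((m₁ m + ρh m) / (1 - ρh m)) ≤ m₁ (m + 1))
    (hV : ∀ m, (a (m + 1) / a m) ^ 2 * ((V m + (1 - 1 / (1 + 1) * Real.sqrt (1 / (1 + 1)) * Real.exp (-(1 / (2 * 1)))) * ρh m +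
      2 * (m₁ m + ρh m) * (a m / a (m + 1) - 1)) / (1 - ρh m)) ≤ V (m + 1))
    {M : ℕ} (hclose : ∀ m, m < M → ρh m < 1) :
    ∀ m, m < M → 0 ≤ ρ m ∧ ρ m ≤ ρh m ∧ ρ m < 1 := by
  set ψ₁ := (1 : ℝ) / (1 + 1) * Real.sqrt (1 / (1 + 1)) * Real.exp (-(1 / (2 * 1))) with hψ₁
  -- the invariant: positivity of the carried ratios and register domination of the two moments' chord value
  have key : ∀ m, m ≤ M → (∀ i, i < m → 0 ≤ b m i) ∧ ∑ i ∈ range m, (a m / a i) * b m i ≤ m₁ m ∧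
      2 * ∑ i ∈ range m, (a m / a i) * b m i - (1 + ψ₁) * ∑ i ∈ range m, (a m / a i) ^ 2 * b m i ≤ V m := by
    -- from the invariant at `m < M`: the ratio bounds at `m`
    have step : ∀ m, m < M → (∀ i, i < m → 0 ≤ b m i) → ∑ i ∈ range m, (a m / a i) * b m i ≤ m₁ m →
        2 * ∑ i ∈ range m, (a m / a i) * b m i - (1 + ψ₁) * ∑ i ∈ range m, (a m / a i) ^ 2 * b m i ≤ V m →
        0 ≤ ρ m ∧ ρ m ≤ ρh m := by
      intro m hm hb hs hc
      have hord : ∀ i, i < m → a m ≤ a i := fun i hi => hanti i m hi.le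
      have hL0 : 0 ≤ ∑ i ∈ range m, (1 - (a i / a m) / (a i / a m + 1) * Real.sqrt ((a i / a m) / (a i / a m + 1)) *
          Real.exp (-(1 / (2 * (a i / a m))))) * b m i :=
        sum_nonneg fun i hi => mul_nonneg (thetabar_mem_unit_interval (div_pos (ha i) (ha m))).1 (hb i (mem_range.mp hi))
      have hLV : ∑ i ∈ range m, (1 - (a i / a m) / (a i / a m + 1) * Real.sqrt ((a i / a m) / (a i / a m + 1)) *
          Real.exp (-(1 / (2 * (a i / a m))))) * b m i ≤ V m := (load_le_chord ha hord hb).trans hc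
      have h := ratio_mono (hx m).1 (hx m).2 hL0 hLV (hΩ m).1 (hΩ m).2
      rw [← hρ m] at h
      refine ⟨?_, h.trans (hρh m)⟩
      rw [hρ m]
      exact div_nonneg (mul_nonneg (hx m).1 (by linarith)) (by linarith [(hΩ m).1, (hΩ m).2])
    intro m
    induction m with
    | zero => intro _; exact ⟨fun i hi => absurd hi (Nat.not_lt_zero i), by simp [h0.1], by simp [h0.2]⟩
    | succ m ih =>
      intro hm
      have hmM : m < M := Nat.lt_of_succ_le hm
      obtain ⟨hb, hs, hc⟩ := ih hmM.le
      obtain ⟨hρ0, hρρ⟩ := step m hmM hb hs hc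
      exact register_inv_succ ha hanti hnew hold hb hρ0 hρρ (hclose m hmM) hs hc (hm₁ m) (hV m)
  intro m hm
  obtain ⟨hb, hs, hc⟩ := key m hm.le
  have hord : ∀ i, i < m → a m ≤ a i := fun i hi => hanti i m hi.le
  have hL0 : 0 ≤ ∑ i ∈ range m, (1 - (a i / a m) / (a i / a m + 1) * Real.sqrt ((a i / a m) / (a i / a m + 1)) *
      Real.exp (-(1 / (2 * (a i / a m))))) * b m i :=
    sum_nonneg fun i hi => mul_nonneg (thetabar_mem_unit_interval (div_pos (ha i) (ha m))).1 (hb i (mem_range.mp hi))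
  have hLV : ∑ i ∈ range m, (1 - (a i / a m) / (a i / a m + 1) * Real.sqrt ((a i / a m) / (a i / a m + 1)) *
      Real.exp (-(1 / (2 * (a i / a m))))) * b m i ≤ V m := (load_le_chord ha hord hb).trans hc
  have h := ratio_mono (hx m).1 (hx m).2 hL0 hLV (hΩ m).1 (hΩ m).2
  rw [← hρ m] at h
  have hρ0 : 0 ≤ ρ m := by
    rw [hρ m]; exact div_nonneg (mul_nonneg (hx m).1 (by linarith)) (by linarith [(hΩ m).1, (hΩ m).2])
  exact ⟨hρ0, h.trans (hρh m), lt_of_le_of_lt (h.trans (hρh m)) (hclose m hm)⟩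

/-! ## §4 Budget-side register laws (continuum letters) — why forgetting a coordinate is safe -/

/-- The usage charge dominates its two-moment part: `u − u²∕4 ≤ 2(√(1+u) − 1)` for `0 ≤ u ≤ 1` (`(1 + u∕2 − u²∕8)² ≤ 1 + u`). [folklore] -/
theorem usage_charge_ge_linear {u : ℝ} (h0 : 0 ≤ u) (h1 : u ≤ 1) : u - u ^ 2 / 4 ≤ 2 * (Real.sqrt (1 + u) - 1) := by
  have hsq : (1 + u / 2 - u ^ 2 / 8) ^ 2 ≤ 1 + u := by
    have e : (1 + u / 2 - u ^ 2 / 8) ^ 2 = 1 + u - u ^ 3 / 8 + u ^ 4 / 64 := by ring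
    rw [e]
    nlinarith [mul_nonneg (pow_nonneg h0 3) (show (0 : ℝ) ≤ 8 - u by linarith)]
  have h := Real.le_sqrt_of_sq_le hsq
  linarith

/-- **USAGE DECAYS NO FASTER THAN `1∕λ`.**  For `λ ≥ 1` and `u ≥ 0`: `2(√(1+u)−1)∕λ ≤ 2(√(1+u∕λ)−1)` — the charge `g` is concave with `g(0) = 0`; proof by
squaring: with `w = √(1+u∕λ·λ)…`, `1 + λv ≤ (1 + λ(√(1+v)−1))²` for `v = u∕λ`.  So the one-register law `U ↦ U∕λ` under a descent by `λ` is a lower bound of the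
true usage of the young's own line by the older loads. [folklore] -/
theorem usage_charge_scale {u lam : ℝ} (hu : 0 ≤ u) (hlam : 1 ≤ lam) :
    2 * (Real.sqrt (1 + u) - 1) / lam ≤ 2 * (Real.sqrt (1 + u / lam) - 1) := by
  have hlam0 : 0 < lam := by linarith
  set v := u / lam with hv
  have hv0 : 0 ≤ v := div_nonneg hu hlam0.le
  have huv : u = lam * v := by rw [hv]; field_simp
  set w := Real.sqrt (1 + v) - 1 with hw
  have hw0 : 0 ≤ w := by
    have : 1 ≤ Real.sqrt (1 + v) := Real.one_le_sqrt.2 (by linarith)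
    linarith
  have hsv : Real.sqrt (1 + v) ^ 2 = 1 + v := Real.sq_sqrt (by linarith)
  have hvw : v = w ^ 2 + 2 * w := by rw [hw]; nlinarith [hsv]
  -- `√(1 + λv) ≤ 1 + λw`
  have hkey : Real.sqrt (1 + lam * v) ≤ 1 + lam * w := by
    refine Real.sqrt_le_iff.mpr ⟨by positivity, ?_⟩
    rw [hvw]
    nlinarith [mul_nonneg (mul_nonneg hlam0.le (mul_nonneg hw0 hw0)) (show (0 : ℝ) ≤ lam - 1 by linarith)]
  rw [div_le_iff₀ hlam0, huv]
  nlinarith [hkey]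

/-- The two-register descent law `M₁∕λ − (M₁ − U)∕λ²` is monotone increasing in `M₁` and in `U` for `λ ≥ 1`. [folklore] -/
theorem two_register_descent_mono {M₁ M₁' U U' lam : ℝ} (hlam : 1 ≤ lam) (hM : M₁ ≤ M₁') (hU : U ≤ U') :
    M₁ / lam - (M₁ - U) / lam ^ 2 ≤ M₁' / lam - (M₁' - U') / lam ^ 2 := by
  have hlam0 : 0 < lam := by linarith
  have e : ∀ A B : ℝ, A / lam - (A - B) / lam ^ 2 = A * (1 / lam - 1 / lam ^ 2) + B / lam ^ 2 := fun A B => by field_simp; ring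
  rw [e, e]
  have hc : 0 ≤ 1 / lam - 1 / lam ^ 2 := by
    rw [div_sub_div _ _ hlam0.ne' (pow_ne_zero 2 hlam0.ne')]
    exact div_nonneg (by nlinarith) (by positivity)
  exact add_le_add (mul_le_mul_of_nonneg_right hM hc) (div_le_div_of_nonneg_right hU (by positivity))

/-- **THE TWO-REGISTER LAW IS A LOWER BOUND OF THE USAGE AFTER ANY DESCENT.**  Older loads `x_k ≥ 0` at relative positions `u_k ∈ [0,1]` on the young's
line; registers `M₁ ≤ Σ x_k u_k` and `U ≤ Σ x_k(u_k − u_k²∕4)`.  After a descent by `λ ≥ 1` the positions become `u_k∕λ` and the true usage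
`Σ x_k·2(√(1+u_k∕λ)−1)` is at least `M₁∕λ − (M₁−U)∕λ²`. [folklore] -/
theorem two_register_descent_le_usage {x u : ℕ → ℝ} {n : ℕ} {M₁ U lam : ℝ} (hx : ∀ k, 0 ≤ x k) (hu : ∀ k, 0 ≤ u k ∧ u k ≤ 1)
    (hM : M₁ ≤ ∑ k ∈ range n, x k * u k) (hU : U ≤ ∑ k ∈ range n, x k * (u k - u k ^ 2 / 4)) (hlam : 1 ≤ lam) :
    M₁ / lam - (M₁ - U) / lam ^ 2 ≤ ∑ k ∈ range n, x k * (2 * (Real.sqrt (1 + u k / lam) - 1)) := by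
  have hlam0 : 0 < lam := by linarith
  refine (two_register_descent_mono hlam hM hU).trans ?_
  have e : (∑ k ∈ range n, x k * u k) / lam - ((∑ k ∈ range n, x k * u k) - ∑ k ∈ range n, x k * (u k - u k ^ 2 / 4)) / lam ^ 2 =
      ∑ k ∈ range n, x k * (u k / lam - (u k / lam) ^ 2 / 4) := by
    rw [sum_div, ← sum_sub_distrib, sum_div, ← sum_sub_distrib]
    exact sum_congr rfl fun k _ => by field_simp; ring
  rw [e]
  refine sum_le_sum fun k _ => mul_le_mul_of_nonneg_left ?_ (hx k)
  have h1 : u k / lam ≤ 1 := by rw [div_le_one hlam0]; exact (hu k).2.trans hlam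
  exact usage_charge_ge_linear (div_nonneg (hu k).1 hlam0.le) h1

/-- **FAR-LINE FOLDING.**  The young's charge on an older line dominates the separable form `2√σ(1−√σ)`: `2√σ·(1 − √σ) ≤ 2(√(σ+σ²) − σ)` for `σ ≥ 0` — so an
older line `J` with residual `r` at relative position `σ₀ = y∕J` constrains all future loads `k ≤ y` through ONE aggregate, `Σ x_k√(k∕J) ≤ r∕(2(1−√σ₀))`.
[folklore] -/
theorem young_charge_ge_fold {σ : ℝ} (hσ : 0 ≤ σ) :
    2 * Real.sqrt σ * (1 - Real.sqrt σ) ≤ 2 * (Real.sqrt (σ + σ ^ 2) - σ) := by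
  have hs : Real.sqrt σ * Real.sqrt σ = σ := Real.mul_self_sqrt hσ
  have h1 : Real.sqrt σ ≤ Real.sqrt (σ + σ ^ 2) := Real.sqrt_le_sqrt (by nlinarith)
  nlinarith [h1, hs]

end Summit.QuantumFields.BalabanUV.Beta.EriceRemainderEnclosureHistoryAutonomyComparisonAgeCompositionStaticChainMonotoneGame

end
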